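import Summits.AnomalousDissipation.AnomalousDissipation.Theses.TwoAndHalfD
import Literature.Analysis.FunctionSpaces.TorusInverseLaplacianCalculus
import Literature.Analysis.FunctionSpaces.TorusClassicalNSUniqueness

/-!
# Q1 `stub_vorticityEquation` — the classical planar vorticity equation (the Prandtl-one twin)
# (line `Sketch`, crux stmt-AnomalousDissipation-0206)

Registered tool stub (section Q, selectivity of the witness's mixing) of the line `Sketch` (duhamel-release)
for the crux `Summit.AnomalousDissipation.AnomalousDissipation.Theses.TwoAndHalfD.TwohalfdThesis`
(stmt-AnomalousDissipation-0206).

CONTENT.  For a classical solution `(v, p)` of the planar Navier–Stokes system on `[0, ∞) × T²` with a steady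
smooth force `g` (any `ν`), the scalar vorticity `ω(t) = ∂₀v₁(t) − ∂₁v₀(t)` is a classical solution of the
SOURCED scalar equation `∂ₜω + v·∇ω = νΔω + curl g` on `[0, ∞)` over the same drift with the same
diffusivity (`Torus.IsClassicalScalarTransportForcedOn (Ici 0) ν v (curl g) ω`).

* `vortEq_timeDerivWithin_partialDeriv_comm` — `∂ₜ∂ⱼ = ∂ⱼ∂ₜ` on `[0, ∞) × T²` (the tree's slab version on
  `Icc 0 (t+1)` transported by `IsSmoothSpaceTimeOn.timeDerivWithin_eq_of_subset`);
* `vortEq_timeDerivWithin_curl` — `∂ₜ(∂₀v₁ − ∂₁v₀) = ∂₀(∂ₜv)₁ − ∂₁(∂ₜv)₀`;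
* `vortEq_partialDeriv_accel` — `∂ⱼ` of the momentum balance, coordinate `i`:
  `∂ⱼ(∂ₜv)ᵢ = νΔ(∂ⱼvᵢ) − ∂ⱼ∂ᵢp + ∂ⱼgᵢ − ∑ₖ (vₖ ∂ⱼ∂ₖvᵢ + ∂ⱼvₖ ∂ₖvᵢ)`;
* `vortEq_slice` — the pointwise identity on one time slice: antisymmetrising `(j,i) = (0,1) − (1,0)`, the
  pressure Hessian cancels (Schwarz), the stretching terms collapse to `(div v)·ω = 0`, and the rest is
  `−v·∇ω + νΔω + curl g`;
* `stub_vorticityEquation` — the registered statement.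

PROOF.  Pointwise calculus on smooth slices (Majda–Bertozzi 2002, §2.1, eq. (2.6): the 2-D vorticity
equation): `∂ₜ` commutes with `∂ⱼ` (`Torus.timeDerivWithin_partialDeriv_comm`), `∂ⱼΔ = Δ∂ⱼ`
(`Torus.partialDeriv_laplacian_comm`), `∂ⱼ((v·∇)v) = ∑ᵢ (vᵢ ∂ⱼ∂ᵢv + ∂ⱼvᵢ ∂ᵢv)`
(`Torus.partialDeriv_convect_self`), Schwarz (`Torus.partialDeriv_comm`) and `div v = 0`.
Supports stmt-AnomalousDissipation-0206.

## Mathlib / Literature search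

`lean search 'timeDerivWithin_partialDeriv_comm'` (`TorusInverseLaplacianCalculus`, slab `Icc a b`; the `Ici 0`
transport is `liftB_T_partialDeriv_comm` of `…ChainRealisationStubLiftBoundsA` for `Fin 3` only — adapted here),
`'partialDeriv_convect_self|partialDeriv_apply_coord|divergence_eq_sum_partialDeriv_apply'`
(`TorusEnstrophyOrthogonality`), `'laplacian_clm_comp_apply|partialDeriv_laplacian_comm'`
(`TorusInverseLaplacianCalculus`), `'partialDeriv_sub|laplacian_sub'` (`TorusClassicalNSUniqueness`),
`'inner_gradient_eq_sum_mul_partialDeriv'` (`TorusTrigPoly`), `'gradient_eq_sum_partialDeriv'` (`TorusSpaceTime`);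
the tree had the planar vorticity equation only in weak form (`…TwohalfdNegVorticityTransport`) and the steady
3-D Euler curl balance (`…SmoothEulerCoerciveForceStubVorticityTransport`).  `lean find 'vorticity'`: nothing planar
to adapt.
-/

noncomputable section

-- the summit path AnomalousDissipation/AnomalousDissipation duplicates a namespace component
set_option linter.dupNamespace false

namespace Summit.AnomalousDissipation.AnomalousDissipation.Theorems.TwohalfdThesis

open MeasureTheory Set Filter Topology
open scoped ENNReal NNReal InnerProductSpace
open Literature.Analysis.FunctionSpaces Literature.Analysis.FluidPDE

/-- **`∂ₜ∂ⱼ = ∂ⱼ∂ₜ` for jointly smooth planar fields on `[0, ∞) × T²`** (one-sided at `t = 0`): the tree's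
slab version `Torus.timeDerivWithin_partialDeriv_comm` on `Icc 0 (t+1)`, transported to `Ici 0` by
`Torus.IsSmoothSpaceTimeOn.timeDerivWithin_eq_of_subset`. [folklore] -/
theorem vortEq_timeDerivWithin_partialDeriv_comm
    {u : ℝ → UnitAddTorus (Fin 2) → EuclideanSpace ℝ (Fin 2)} (hu : Torus.IsSmoothSpaceTimeOn (Ici 0) u)
    {t : ℝ} (ht : t ∈ Ici (0 : ℝ)) (j : Fin 2) (x : UnitAddTorus (Fin 2)) :
    Torus.timeDerivWithin (Ici 0) (fun s => Torus.partialDeriv j (u s)) t x =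
      Torus.partialDeriv j (Torus.timeDerivWithin (Ici 0) u t) x := by
  -- adapted from `liftB_T_partialDeriv_comm` (Theorems/MarginalStabilityChainChainRealisationStubLiftBoundsA)
  have ht0 : (0 : ℝ) ≤ t := ht
  have hb : (0 : ℝ) < t + 1 := by linarith
  have hsub : Icc 0 (t + 1) ⊆ Ici (0 : ℝ) := Icc_subset_Ici_self
  have ht' : t ∈ Icc 0 (t + 1) := ⟨ht0, by linarith⟩
  rw [← (hu.partialDeriv (uniqueDiffOn_Ici 0) j).timeDerivWithin_eq_of_subset hsub (uniqueDiffOn_Icc hb) ht' x,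
    Torus.timeDerivWithin_partialDeriv_comm hb (hu.mono hsub) ht' j x]
  congr 1
  funext y
  exact hu.timeDerivWithin_eq_of_subset hsub (uniqueDiffOn_Icc hb) ht' y

/-- **The time derivative of the planar vorticity is the vorticity of the acceleration**:
`∂ₜ(∂₀u₁ − ∂₁u₀) = ∂₀(∂ₜu)₁ − ∂₁(∂ₜu)₀` on `[0, ∞) × T²` (coordinates and differences commute with the
one-sided time derivative of the jointly smooth fields `∂ⱼu`, then `vortEq_timeDerivWithin_partialDeriv_comm`).
[folklore] -/
theorem vortEq_timeDerivWithin_curl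
    {u : ℝ → UnitAddTorus (Fin 2) → EuclideanSpace ℝ (Fin 2)} (hu : Torus.IsSmoothSpaceTimeOn (Ici 0) u)
    {t : ℝ} (ht : t ∈ Ici (0 : ℝ)) (x : UnitAddTorus (Fin 2)) :
    Torus.timeDerivWithin (Ici 0)
        (fun s y => Torus.partialDeriv 0 (u s) y 1 - Torus.partialDeriv 1 (u s) y 0) t x =
      Torus.partialDeriv 0 (Torus.timeDerivWithin (Ici 0) u t) x 1 -
        Torus.partialDeriv 1 (Torus.timeDerivWithin (Ici 0) u t) x 0 := by
  have hU : UniqueDiffOn ℝ (Ici (0 : ℝ)) := uniqueDiffOn_Ici 0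
  have h0 := (EuclideanSpace.proj (1 : Fin 2) : EuclideanSpace ℝ (Fin 2) →L[ℝ] ℝ).hasFDerivAt.comp_hasDerivWithinAt
    t ((hu.partialDeriv hU 0).hasDerivWithinAt_slice ht x)
  have h1 := (EuclideanSpace.proj (0 : Fin 2) : EuclideanSpace ℝ (Fin 2) →L[ℝ] ℝ).hasFDerivAt.comp_hasDerivWithinAt
    t ((hu.partialDeriv hU 1).hasDerivWithinAt_slice ht x)
  rw [← vortEq_timeDerivWithin_partialDeriv_comm hu ht 0 x, ← vortEq_timeDerivWithin_partialDeriv_comm hu ht 1 x]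
  exact (h0.sub h1).derivWithin (hU t ht)

/-- **`∂ⱼ` of the momentum balance, coordinate `i`.**  If `A + (V·∇)V = νΔV − ∇P + g` pointwise on `T²` with
`V`, `g`, `P` smooth, then
`(∂ⱼA)ᵢ = ν Δ(∂ⱼVᵢ) − ∂ⱼ∂ᵢP + ∂ⱼgᵢ − ∑ₖ (Vₖ (∂ⱼ∂ₖV)ᵢ + ∂ⱼVₖ (∂ₖV)ᵢ)`
(`∂ⱼ` distributes; `∂ⱼΔ = Δ∂ⱼ` and coordinates commute with `Δ`; `(∇P)ᵢ = ∂ᵢP`; Leibniz for the convective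
term, `Torus.partialDeriv_convect_self`). [folklore] -/
theorem vortEq_partialDeriv_accel {ν : ℝ} {V g A : UnitAddTorus (Fin 2) → EuclideanSpace ℝ (Fin 2)}
    {P : UnitAddTorus (Fin 2) → ℝ} (hV : Torus.IsSmooth V) (hg : Torus.IsSmooth g) (hP : Torus.IsSmooth P)
    (hA : ∀ y, A y + Torus.convect V V y = ν • Torus.laplacian V y - Torus.gradient P y + g y)
    (j i : Fin 2) (x : UnitAddTorus (Fin 2)) :
    Torus.partialDeriv j A x i =
      ν * Torus.laplacian (fun y => Torus.partialDeriv j V y i) x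
        - Torus.partialDeriv j (Torus.partialDeriv i P) x + Torus.partialDeriv j g x i
        - ∑ k, (V x k * Torus.partialDeriv j (Torus.partialDeriv k V) x i +
            Torus.partialDeriv j V x k * Torus.partialDeriv k V x i) := by
  -- the acceleration as a combination of smooth fields
  have hAeq : A = ν • Torus.laplacian V - Torus.gradient P + g - Torus.convect V V := by
    funext y
    simp only [Pi.sub_apply, Pi.add_apply, Pi.smul_apply]
    rw [eq_sub_iff_add_eq]
    exact hA y
  have hΔ : Torus.IsContDiff 1 (Torus.laplacian V) := hV.laplacian.isContDiff (by simp)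
  have hνΔ : Torus.IsContDiff 1 (ν • Torus.laplacian V) := hΔ.smul ν
  have hP1 : Torus.IsContDiff 1 P := hP.isContDiff (by simp)
  have hGP : Torus.IsContDiff 1 (Torus.gradient P) := hP.gradient.isContDiff (by simp)
  have hg1 : Torus.IsContDiff 1 g := hg.isContDiff (by simp)
  have hC : Torus.IsContDiff 1 (Torus.convect V V) := (hV.convect hV).isContDiff (by simp)
  have h12 : Torus.IsContDiff 1 (ν • Torus.laplacian V - Torus.gradient P) := ContDiff.sub hνΔ hGP
  have h123 : Torus.IsContDiff 1 (ν • Torus.laplacian V - Torus.gradient P + g) := h12.add hg1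
  -- `∂ⱼ` distributes over the combination
  have hdist : Torus.partialDeriv j A x i =
      ν * Torus.partialDeriv j (Torus.laplacian V) x i - Torus.partialDeriv j (Torus.gradient P) x i
        + Torus.partialDeriv j g x i - Torus.partialDeriv j (Torus.convect V V) x i := by
    rw [hAeq, Torus.partialDeriv_sub h123 hC, Torus.partialDeriv_add h12 hg1, Torus.partialDeriv_sub hνΔ hGP,
      Torus.partialDeriv_const_smul hΔ]
    simp only [Pi.sub_apply, Pi.add_apply, Pi.smul_apply, PiLp.sub_apply, PiLp.add_apply, PiLp.smul_apply,
      smul_eq_mul]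
  -- viscous term: `(∂ⱼΔV)ᵢ = Δ(∂ⱼVᵢ)`
  have hvisc : Torus.partialDeriv j (Torus.laplacian V) x i =
      Torus.laplacian (fun y => Torus.partialDeriv j V y i) x := by
    rw [Torus.partialDeriv_laplacian_comm hV j x]
    exact (Torus.laplacian_clm_comp_apply (hV.partialDeriv j) (EuclideanSpace.proj i) x).symm
  -- pressure term: `(∂ⱼ∇P)ᵢ = ∂ⱼ∂ᵢP`
  have hpress : Torus.partialDeriv j (Torus.gradient P) x i = Torus.partialDeriv j (Torus.partialDeriv i P) x := by
    rw [← Torus.partialDeriv_apply_coord hGP j x i]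
    congr 1
    funext y
    rw [Torus.gradient_eq_sum_partialDeriv hP1]
    fin_cases i <;> simp
  -- convective term, coordinate `i`
  have hconv : Torus.partialDeriv j (Torus.convect V V) x i =
      ∑ k, (V x k * Torus.partialDeriv j (Torus.partialDeriv k V) x i +
        Torus.partialDeriv j V x k * Torus.partialDeriv k V x i) := by
    rw [Torus.partialDeriv_convect_self hV j x, WithLp.ofLp_sum, Finset.sum_apply]
    simp only [WithLp.ofLp_add, WithLp.ofLp_smul, Pi.add_apply, Pi.smul_apply, smul_eq_mul]
  rw [hdist, hvisc, hpress, hconv]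

/-- **The vorticity identity on one time slice.**  If `A + (V·∇)V = νΔV − ∇P + g` pointwise on `T²` with `V`,
`g`, `P` smooth and `div V = 0`, then, with `W = ∂₀V₁ − ∂₁V₀`,
`(∂₀A)₁ − (∂₁A)₀ + ⟪V, ∇W⟫ = ν ΔW + (∂₀g₁ − ∂₁g₀)`:
antisymmetrise `vortEq_partialDeriv_accel` in `(j,i) = (0,1) − (1,0)`; the pressure Hessian cancels and the second
derivatives of `V` combine to `−⟪V, ∇W⟫` by Schwarz (`Torus.partialDeriv_comm`), the stretching terms to
`−(∂₀V₀ + ∂₁V₁)·W = −(div V)·W = 0`. [folklore] -/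
theorem vortEq_slice {ν : ℝ} {V g A : UnitAddTorus (Fin 2) → EuclideanSpace ℝ (Fin 2)}
    {P : UnitAddTorus (Fin 2) → ℝ} (hV : Torus.IsSmooth V) (hg : Torus.IsSmooth g) (hP : Torus.IsSmooth P)
    (hdiv : Torus.IsDivFree V)
    (hA : ∀ y, A y + Torus.convect V V y = ν • Torus.laplacian V y - Torus.gradient P y + g y)
    (x : UnitAddTorus (Fin 2)) :
    Torus.partialDeriv 0 A x 1 - Torus.partialDeriv 1 A x 0 +
        ⟪V x, Torus.gradient (fun y => Torus.partialDeriv 0 V y 1 - Torus.partialDeriv 1 V y 0) x⟫_ℝ =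
      ν * Torus.laplacian (fun y => Torus.partialDeriv 0 V y 1 - Torus.partialDeriv 1 V y 0) x +
        (Torus.partialDeriv 0 g x 1 - Torus.partialDeriv 1 g x 0) := by
  have hV1 : Torus.IsContDiff 1 V := hV.isContDiff (by simp)
  have hD : ∀ j, Torus.IsSmooth (Torus.partialDeriv j V) := fun j => hV.partialDeriv j
  have hDc : ∀ j i, Torus.IsSmooth (fun y => Torus.partialDeriv j V y i) := fun j i => (hD j).apply i
  -- the vorticity `W = ∂₀V₁ − ∂₁V₀` as a difference of smooth scalar fields
  have hWdef : (fun y => Torus.partialDeriv 0 V y 1 - Torus.partialDeriv 1 V y 0) =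
      (fun y => Torus.partialDeriv 0 V y 1) - fun y => Torus.partialDeriv 1 V y 0 := rfl
  have hW1 : Torus.IsContDiff 1 (fun y => Torus.partialDeriv 0 V y 1 - Torus.partialDeriv 1 V y 0) :=
    ((hDc 0 1).sub (hDc 1 0)).isContDiff (by simp)
  -- advection: `⟪V, ∇W⟫ = ∑ₖ Vₖ ((∂ₖ∂₀V)₁ − (∂ₖ∂₁V)₀)`
  have hadv : ⟪V x, Torus.gradient (fun y => Torus.partialDeriv 0 V y 1 - Torus.partialDeriv 1 V y 0) x⟫_ℝ =
      ∑ k, V x k * (Torus.partialDeriv k (Torus.partialDeriv 0 V) x 1 -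
        Torus.partialDeriv k (Torus.partialDeriv 1 V) x 0) := by
    rw [Torus.inner_gradient_eq_sum_mul_partialDeriv hW1 (V x) x]
    refine Finset.sum_congr rfl fun k _ => ?_
    rw [hWdef, Torus.partialDeriv_sub ((hDc 0 1).isContDiff (by simp)) ((hDc 1 0).isContDiff (by simp)) k,
      Pi.sub_apply, Torus.partialDeriv_apply_coord ((hD 0).isContDiff (by simp)) k x 1,
      Torus.partialDeriv_apply_coord ((hD 1).isContDiff (by simp)) k x 0]
  -- diffusion: `ΔW = Δ(∂₀V₁) − Δ(∂₁V₀)`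
  have hlap : Torus.laplacian (fun y => Torus.partialDeriv 0 V y 1 - Torus.partialDeriv 1 V y 0) x =
      Torus.laplacian (fun y => Torus.partialDeriv 0 V y 1) x -
        Torus.laplacian (fun y => Torus.partialDeriv 1 V y 0) x := by
    rw [hWdef, Torus.laplacian_sub (hDc 0 1) (hDc 1 0), Pi.sub_apply]
  -- Schwarz for `V` and `P`; incompressibility
  have hSV : Torus.partialDeriv 1 (Torus.partialDeriv 0 V) x = Torus.partialDeriv 0 (Torus.partialDeriv 1 V) x :=
    Torus.partialDeriv_comm hV 1 0 x
  have hS0 : Torus.partialDeriv 1 (Torus.partialDeriv 0 V) x 0 = Torus.partialDeriv 0 (Torus.partialDeriv 1 V) x 0 := by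
    rw [hSV]
  have hS1 : Torus.partialDeriv 1 (Torus.partialDeriv 0 V) x 1 = Torus.partialDeriv 0 (Torus.partialDeriv 1 V) x 1 := by
    rw [hSV]
  have hSP : Torus.partialDeriv 0 (Torus.partialDeriv 1 P) x = Torus.partialDeriv 1 (Torus.partialDeriv 0 P) x :=
    Torus.partialDeriv_comm hP 0 1 x
  have hdiv0 : Torus.partialDeriv 0 V x 0 + Torus.partialDeriv 1 V x 1 = 0 := by
    have h := hdiv x
    rw [Torus.divergence_eq_sum_partialDeriv_apply hV1 x, Fin.sum_univ_two] at h
    exact h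
  rw [vortEq_partialDeriv_accel hV hg hP hA 0 1 x, vortEq_partialDeriv_accel hV hg hP hA 1 0 x, hadv, hlap]
  simp only [Fin.sum_univ_two]
  linear_combination (-1 : ℝ) * hSP + V x 0 * hS0 + V x 1 * hS1 +
    (Torus.partialDeriv 1 V x 0 - Torus.partialDeriv 0 V x 1) * hdiv0

/-- **Q1 `stub_vorticityEquation` — THE TWIN: classical planar vorticity equation.**  For a classical solution
`(v, p)` of the planar Navier–Stokes system on `[0, ∞) × T²` with steady smooth force `g` (any `ν`), the scalar
vorticity `ω(t) = ∂₀v₁(t) − ∂₁v₀(t)` is a classical solution of the SOURCED scalar equation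
`∂ₜω + v·∇ω = νΔω + curl g` on `[0, ∞)` over the same drift with the same diffusivity.  Smoothness of `ω` and
of the source: `IsSmoothSpaceTimeOn.partialDeriv/.apply/.sub`, `isSmoothSpaceTimeOn_const`; the equation:
`vortEq_timeDerivWithin_curl` (`∂ₜω = (∂₀∂ₜv)₁ − (∂₁∂ₜv)₀`) and `vortEq_slice` applied to the momentum equation
on the slice `t` (Majda–Bertozzi 2002, §2.1). [folklore] -/
theorem stub_vorticityEquation :
    ∀ (ν : ℝ) (g : (UnitAddTorus (Fin 2)) → (EuclideanSpace ℝ (Fin 2)))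
      (v : ℝ → (UnitAddTorus (Fin 2)) → (EuclideanSpace ℝ (Fin 2))) (p : ℝ → (UnitAddTorus (Fin 2)) → ℝ),
      Torus.IsSmooth g → Torus.IsClassicalNSSolutionOn (Ici 0) ν (fun _ => g) v p →
      Torus.IsClassicalScalarTransportForcedOn (Ici 0) ν v
        (fun _ x => Torus.partialDeriv 0 g x 1 - Torus.partialDeriv 1 g x 0)
        (fun t x => Torus.partialDeriv 0 (v t) x 1 - Torus.partialDeriv 1 (v t) x 0) := by
  intro ν g v p hg hNS
  have hU : UniqueDiffOn ℝ (Ici (0 : ℝ)) := uniqueDiffOn_Ici 0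
  have hv : Torus.IsSmoothSpaceTimeOn (Ici 0) v := hNS.smooth_velocity
  have hcurlg : Torus.IsSmooth (fun x => Torus.partialDeriv 0 g x 1 - Torus.partialDeriv 1 g x 0) :=
    ((hg.partialDeriv 0).apply 1).sub ((hg.partialDeriv 1).apply 0)
  refine
    { smooth_velocity := hv
      smooth_source := Torus.isSmoothSpaceTimeOn_const hcurlg (Ici 0)
      smooth_scalar := ((hv.partialDeriv hU 0).apply 1).sub ((hv.partialDeriv hU 1).apply 0)
      transport := ?_
      divFree := hNS.divFree }
  intro t ht x
  show Torus.timeDerivWithin (Ici 0)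
        (fun s y => Torus.partialDeriv 0 (v s) y 1 - Torus.partialDeriv 1 (v s) y 0) t x +
      ⟪v t x, Torus.gradient (fun y => Torus.partialDeriv 0 (v t) y 1 - Torus.partialDeriv 1 (v t) y 0) x⟫_ℝ =
    ν * Torus.laplacian (fun y => Torus.partialDeriv 0 (v t) y 1 - Torus.partialDeriv 1 (v t) y 0) x +
      (Torus.partialDeriv 0 g x 1 - Torus.partialDeriv 1 g x 0)
  rw [vortEq_timeDerivWithin_curl hv ht x]
  exact vortEq_slice (A := Torus.timeDerivWithin (Ici 0) v t) (hv.isSmooth_slice ht) hg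
    (hNS.smooth_pressure.isSmooth_slice ht) (hNS.divFree t ht) (hNS.momentum t ht) x

end Summit.AnomalousDissipation.AnomalousDissipation.Theorems.TwohalfdThesis
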